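import Mathlib
import HarnessLib
import Summits.HubbardSuperconductivity.HubbardSuperconductivity.Theorems.KLProgrammeKLRegimeEngineTowerWtNumericsBounds
import Summits.HubbardSuperconductivity.HubbardSuperconductivity.Theorems.KLProgrammeKLRegimeEngineTowerWtNumericsPins
import Summits.HubbardSuperconductivity.HubbardSuperconductivity.Theorems.KLProgrammeKLRegimeEngineTowerLevNumericsBounds
import Summits.HubbardSuperconductivity.HubbardSuperconductivity.Theorems.KLProgrammeKLRegimeEngineTowerLevNumericsG
import Summits.HubbardSuperconductivity.HubbardSuperconductivity.Theorems.KLProgrammeKLRegimeEngineTowerLevNumericsPackageZN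

/-!
# Route `KLProgramme` — crux K3 ENGINE (stmt-HubbardSuperconductivity-20437 `KLRegimeEngineV17F2`), stub (b) v2, THE WEIGHTED HALF «(b)-WT4», numerics side
# (cell gate-hubbard-kl, seat p4 g22): THE MAIN WEIGHTED TOWER's NUMERICS PACKAGE WITH A c-CLASS TWO-LEG IMPORT («E-b1-2LEG-SHAPE» cure, numerics half) —
# `levNumerics_packageW` with the two-leg slot read as a PRODUCT BOUND `ι₁·λ ≤ g·(M/β)` at every rate (rate-indexed `ι₁`), `g ≤ gmax` a (U, c)-door

«E-b1-2LEG-SHAPE» (p3 g23, confirmed p4 g22): E1's two-leg import at the main tower is c-class (`O(|U| + c)`), so a rate-free `ι₁` with rows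
`W·Z·μ(d,k,1) ≤ ι₁·λ_j` at every rate is unfillable U-uniformly; the cure is a rate-indexed `ι₁ j := X₂(M/β)/λ_j`, i.e. the numerics may only use the
PRODUCT `ι₁ j·λ_j ≤ gmax·(M/β)`.  This is `levNumerics_packageW` (p705312) re-keyed to that reading: NumericsG is instantiated with its two-leg slot ZEROED
and the budget absorbed into the four-leg slot (`ι₂ᴳ = ι₂ + 2Q″·gmax(M/β)`; `Y = ι₂/(2Q″) + WZ³X/(4Q″²) + aQ″/2 + gmax·(M/β)` and `A A′` pinned on this `Y`),
giving the y-row and the closing row at a size `S′ ≥ S` (`levNumW_rows_monoS`) with doors 4 and 7 trivial; the θ-row is `levNum_θ₀_le'` (product slot) with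
`e·pφ·pt·gmax ≤ 1/4` and the member `1/(4Θ + 1)` of `uf`; the amplitude rows absorb `gmax ≤ 1/Kx` with the DOUBLED ratios `K₁ = 16pφpt`,
`K₂ = 256e·pp³pt⁴pφpκ/((1−2^{−d})pρ³)`.  Closed forms (r-free, `rfl` at the call): pins, `K₁ K₂ Kx`, **`gmax = min 1 (min (1/Kx) (1/(4e·pφ·pt)))`**,
`q₀₀ = 1 + (i₂ + x₆)·Kx`, `QH`, `BfW = (pW + pκ)·ab·QH·Kx` (`Bf ≥ max 1 BfW`), `yP₀ yP yL aP aA aL i₃g i₂G sC Sfive R₆ Θ`, **`uf`** (six members), `qT aT`,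
**`CEf = qT·Bf·max 1 (2aT)`**; blocking `max 1 pZ·C₂²·pρ ≤ 2^{d−1}`.  **`levNumerics_packageWN`** ⊢ `0 < uf ∧ 0 ≤ CEf ∧ 1 ≤ Bf ∧ 0 < gmax` and, for
`0 < β ≤ M` and the shaped/pinned data (`ι₂ = i₂(M/β)³`, `ι₃ = x₆(M/β)⁵`; NO `ι₁`): (o) signs + W10's four dominations; (i) for every `0 ≤ λ ≤ uf` AND EVERY
`ι₁ ≥ 0` WITH `ι₁·λ ≤ gmax·(M/β)` the eight kit rows verbatim; (ii) the sharp CE row for the same `(λ, ι₁)`.  The glue reads `ι₁ := ι₁ k j` per rate and gets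
`ι₁ k j·λ_j ≤ gmax·(M/β)` from E1's c-class row by (U, c)-doors.  Pure real arithmetic; nothing about the model is asserted; nothing asserts (b), WT4, (ℓ),
any stub, K3 or superconductivity.  References: BGM 2006 §2.8 (2.83)–(2.84), (2.93)–(2.98), Lemma 2.5 (2.98) [cite: BenfattoGiulianiMastropietro2006].
-/

noncomputable section

namespace Summit.HubbardSuperconductivity.HubbardSuperconductivity.Theorems.EngineV8

set_option linter.dupNamespace false -- summit = problem name (single-conjunct summit), D-0017

open Real Literature.MathematicalPhysics.QuantumLattice
open Summit.HubbardSuperconductivity.HubbardSuperconductivity.Theorems.KLRegimeSplit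

section MonoS

variable {Φ τ ψ σ Q' Q A A' lam S S' : ℝ}

/-- **The y-row and the closing row are monotone in the re-summed size `S`**: for `0 ≤ S ≤ S′` (and `Φ, τ, ψ, Q′, A′, λ·σ-bracket ≥ 0`) the rows at `S′`
imply the rows at `S`. [folklore] -/
theorem levNumW_rows_monoS (hΦ : 0 ≤ Φ) (hτ : 0 ≤ τ) (hψ : 0 ≤ ψ) (hS0 : 0 ≤ S) (hSS : S ≤ S') :
    (Φ * (τ * S') < 1 → Φ * (τ * S) < 1) ∧
    (Φ * (τ * S') < 1 →
      A' * (4 * Q') ^ 3 * (4 * σ * lam * Q' / (1 - 4 * σ * lam * Q')) + exp 1 * ψ * (2 * τ * ψ * Q') ^ 2 * (τ * S') * (Φ * (τ * S') / (1 - Φ * (τ * S')))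
          ≤ A * Q ^ 3 →
      A' * (4 * Q') ^ 3 * (4 * σ * lam * Q' / (1 - 4 * σ * lam * Q')) + exp 1 * ψ * (2 * τ * ψ * Q') ^ 2 * (τ * S) * (Φ * (τ * S) / (1 - Φ * (τ * S)))
          ≤ A * Q ^ 3) := by
  have hy_mono : Φ * (τ * S) ≤ Φ * (τ * S') := by gcongr
  refine ⟨fun h => lt_of_le_of_lt hy_mono h, fun hy' hc => ?_⟩
  have hy0 : 0 ≤ Φ * (τ * S) := by positivity
  have hy1 : Φ * (τ * S) < 1 := lt_of_le_of_lt hy_mono hy'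
  have hratio : Φ * (τ * S) / (1 - Φ * (τ * S)) ≤ Φ * (τ * S') / (1 - Φ * (τ * S')) := by
    rw [div_le_div_iff₀ (by linarith) (by linarith)]; nlinarith
  have hratio0 : 0 ≤ Φ * (τ * S) / (1 - Φ * (τ * S)) := div_nonneg hy0 (by linarith)
  have hprod : τ * S * (Φ * (τ * S) / (1 - Φ * (τ * S))) ≤ τ * S' * (Φ * (τ * S') / (1 - Φ * (τ * S'))) :=
    mul_le_mul (by gcongr) hratio hratio0 (mul_nonneg hτ (hS0.trans hSS))
  have h2 : exp 1 * ψ * (2 * τ * ψ * Q') ^ 2 * (τ * S) * (Φ * (τ * S) / (1 - Φ * (τ * S))) ≤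
      exp 1 * ψ * (2 * τ * ψ * Q') ^ 2 * (τ * S') * (Φ * (τ * S') / (1 - Φ * (τ * S'))) := by
    have h0 : 0 ≤ exp 1 * ψ * (2 * τ * ψ * Q') ^ 2 := by positivity
    calc exp 1 * ψ * (2 * τ * ψ * Q') ^ 2 * (τ * S) * (Φ * (τ * S) / (1 - Φ * (τ * S)))
        = exp 1 * ψ * (2 * τ * ψ * Q') ^ 2 * (τ * S * (Φ * (τ * S) / (1 - Φ * (τ * S)))) := by ring
      _ ≤ exp 1 * ψ * (2 * τ * ψ * Q') ^ 2 * (τ * S' * (Φ * (τ * S') / (1 - Φ * (τ * S')))) := mul_le_mul_of_nonneg_left hprod h0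
      _ = exp 1 * ψ * (2 * τ * ψ * Q') ^ 2 * (τ * S') * (Φ * (τ * S') / (1 - Φ * (τ * S'))) := by ring
  linarith

end MonoS

set_option maxHeartbeats 2000000 in -- one ~70-binder statement, ~40 constants, NumericsG instantiated twice
/-- **THE MAIN WEIGHTED TOWER's NUMERICS PACKAGE, c-CLASS TWO-LEG IMPORT** (product-bound two-leg slot at every rate; see the module docstring for the choices,
the closed forms and the conclusions (o)–(ii)). [cite: BenfattoGiulianiMastropietro2006, §2.8 (2.83)-(2.84), (2.93)-(2.98), Lemma 2.5 (2.98)] -/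
theorem levNumerics_packageWN
    {C₁ C₂ C₁r C₂r Cinc Dinc Cκ Cb CJ ab qb i₂ x₆ : ℝ} {d : ℕ}
    (hC₁ : 0 < C₁) (hC₂ : 0 < C₂) (hC₁r : 0 < C₁r) (hC₂r : 0 < C₂r) (hCinc : 0 < Cinc) (hDinc : 1 ≤ Dinc)
    (hCκ : 0 < Cκ) (hCb : 0 < Cb) (hCJ : 0 < CJ) (hd : 2 ≤ d) (hab0 : 0 < ab) (hqb0 : 0 < qb) (hi₂ : 0 ≤ i₂) (hx₆ : 0 ≤ x₆)
    -- the r-free closed forms (instantiate with `rfl`)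
    {pW pZ ps pt pp pφ pρ pκ K₁ K₂ Kx gmax q₀₀ QH BfW yP₀ yP yL aP aA aL i₃g i₂G sC Sfive R₆ Θ uf qT aT CEf : ℝ} {Bf : ℝ}
    (hpW : pW = 16) (hpZ : pZ = (81 * CJ) ^ 2 / 8) (hps : ps = 2 * Cκ * klE0 / (162 ^ 2 * CJ ^ 2))
    (hpt : pt = 4 * exp 4 * (2 * Cκ * klE0) / (162 ^ 2 * CJ ^ 2)) (hpp : pp = 162 ^ 2 * CJ ^ 2 / (2 * Cκ * klE0))
    (hpφ : pφ = exp 1 * (Cb * (4 : ℝ) ^ d / klE0) / (Cκ * klE0)) (hpρ : pρ = 8 * exp 4) (hpκ : pκ = pW * ((C₁ / C₂) * (8 : ℝ) ^ (d - 1)))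
    (hK₁ : K₁ = 16 * pφ * pt) (hK₂ : K₂ = 256 * exp 1 * pp ^ 3 * pt ^ 4 * pφ * pκ / ((1 - ((2 : ℝ) ^ d)⁻¹) * pρ ^ 3)) (hKx : Kx = max K₁ K₂)
    (hgmax : gmax = min 1 (min (1 / Kx) (1 / (4 * exp 1 * pφ * pt))))
    (hq₀₀ : q₀₀ = 1 + (i₂ + x₆) * Kx) (hQH : QH = pZ * qb + q₀₀ + 1) (hBfW : BfW = (pW + pκ) * ab * QH * Kx) (hBf : max 1 BfW ≤ Bf)
    (hyP₀ : yP₀ = i₂ / (2 * q₀₀) + x₆ / (4 * q₀₀ ^ 2) + (pW + pκ) * ab * QH / (2 * Bf ^ 2)) (hyP : yP = yP₀ + gmax)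
    (hyL : yL = (pW + pκ) * ab * q₀₀ / (2 * Bf ^ 2))
    (haP : aP = (pW + pκ) * ab / Bf ^ 2 + 2 * yP / q₀₀) (haA : aA = 2 * yP / (pκ * q₀₀)) (haL : aL = 3 * yL / (2 * pκ * QH))
    (hi₃g : i₃g = x₆ + aP * QH ^ 3) (hi₂G : i₂G = i₂ + 2 * QH * gmax) (hsC : sC = i₂ / (2 * q₀₀) + i₃g / (4 * q₀₀ ^ 2) + aP * QH / 4)
    (hSfive : Sfive = exp 1 * pφ * pt * 0 + exp 1 ^ 2 * pφ * pt ^ 2 * i₂G + exp 1 ^ 3 * pφ * pt ^ 3 * i₃g + pφ * aP * exp 1 ^ 2 * pt ^ 2 * QH ^ 2 / 2)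
    (hR₆ : R₆ = 1024 * ps * aP * QH / (aL * pρ ^ 3))
    (hΘ : Θ = exp 1 ^ 2 * pφ * pt ^ 2 * i₂ + exp 1 ^ 3 * pφ * pt ^ 3 * x₆ + exp 1 ^ 3 * pφ * pt ^ 3 * aP * QH ^ 3)
    (huf : uf = min 1 (min (1 / (8 * ps * QH + 1)) (min (1 / (2 * exp 1 * pt * QH + 1))
      (min (1 / (2 * Sfive + 1)) (min (1 / (R₆ + 1)) (1 / (4 * Θ + 1)))))))
    (hqT : qT = Dinc * (1 + C₂r ^ 2 * (pρ * QH + qb) + 4 * QH + 2 * pt * pp * QH) / 4)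
    (haT : aT = C₁r / C₂r * (ab / Bf ^ 2 + aA) + Cinc * (aP + exp 1 * (gmax + sC) / (2 * q₀₀)))
    (hCEf : CEf = qT * Bf * max 1 (2 * aT))
    (hblockW : max 1 pZ * C₂ ^ 2 * pρ ≤ (2 : ℝ) ^ (d - 1)) :
    0 < uf ∧ 0 ≤ CEf ∧ 1 ≤ Bf ∧ 0 < gmax ∧
    ∀ (β : ℝ) (M : ℕ) [NeZero M], 0 < β → β ≤ M →
    -- the base datum: amplitude on its shape, the per-leg constant bounded on its shape
    ∀ (Ab Qb : ℝ), Ab = ab * (β / M) / Bf ^ 2 → 0 ≤ Qb → Qb ≤ qb * ((M : ℝ) / β) ^ 2 →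
    -- the names at the max-dominants (equational) and the pinned four-/six-leg imports (NO two-leg name: it is read per rate in (i)/(ii))
    ∀ (κb αb crb ccb : ℝ), κb = Real.sqrt (2 * Cκ * klE0) → αb = Cb * ((M : ℝ) / β) * (4 : ℝ) ^ d / klE0 →
      crb = 81 * CJ * M / β → ccb = 162 * CJ * M / β →
    ∀ (W Z σ τ ψ Φ : ℝ), W = 32 * crb / ccb → Z = imagTimeWeight β M ^ 2 * ccb ^ 2 / 8 →
      σ = κb ^ 2 / ccb ^ 2 → τ = 4 * exp 4 * κb ^ 2 / ccb ^ 2 → ψ = ccb ^ 2 / κb ^ 2 → Φ = exp 1 * αb * ccb / (κb ^ 2 * crb) →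
    ∀ (ι₂ ι₃ : ℝ), ι₂ = i₂ * ((M : ℝ) / β) ^ 3 → ι₃ = x₆ * ((M : ℝ) / β) ^ 5 →
    -- the (I5)-G choices (equational binders), `Y` carrying the two-leg budget `gmax·(M/β)`
    ∀ (κA q₀ Q'' ρ Q' a X Y A A' : ℝ), κA = W * ((C₁ / C₂) * (8 : ℝ) ^ (d - 1)) → q₀ = q₀₀ * ((M : ℝ) / β) ^ 2 → Q'' = Z * Qb + q₀ + 1 →
      ρ = max 4 (2 * τ * ψ) → Q' = ρ * Q'' → a = W * Ab + κA * Ab → X = ι₃ / (W * Z ^ 3) →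
      Y = ι₂ / (2 * Q'') + W * Z ^ 3 * X / (4 * Q'' ^ 2) + a * Q'' / 2 + gmax * ((M : ℝ) / β) →
      A = 2 * Y * (1 - ((2 : ℝ) ^ d)⁻¹) / (κA * Q'') → A' = a + 2 * Y / Q'' →
    -- (o) signs and W10's four dominations
    (0 ≤ A ∧ 0 < Q' ∧ 0 < Q'' ∧ 0 ≤ A' ∧
      W * ((C₁ / C₂) * (8 : ℝ) ^ (d - 1) * (Ab + A / (1 - ((2 : ℝ) ^ d)⁻¹))) ≤ A' ∧ Z * (C₂ ^ 2 * ((2 : ℝ) ^ (d - 1))⁻¹ * max Q' Qb) ≤ Q'' ∧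
      W * Ab ≤ A' ∧ Z * Qb ≤ Q'') ∧
    -- (i) the eight kit rows at every coupling below `uf` and every two-leg slot whose PRODUCT with the coupling is below `gmax·(M/β)`
    (∀ (lam ι₁ : ℝ), 0 ≤ lam → lam ≤ uf → 0 ≤ ι₁ → ι₁ * lam ≤ gmax * ((M : ℝ) / β) →
      4 * σ * lam * Q'' < 1 ∧ 2 * lam * τ * Q'' ≤ 1 ∧ exp 1 * τ * lam * Q'' < 1 ∧
      Φ * (τ * (ι₁ * lam + ι₂ / (2 * Q'') + ι₃ / (4 * Q'' ^ 2) + A' * Q'' / 4)) < 1 ∧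
      Φ * (exp 1 * τ * (ι₁ * lam) + (exp 1 * τ) ^ 2 * (ι₂ * lam) + (exp 1 * τ) ^ 3 * (ι₃ * lam ^ 2) +
        A' * (exp 1 * τ * Q'') * ((exp 1 * τ * lam * Q'') ^ 3 / (1 - exp 1 * τ * lam * Q''))) < 1 ∧
      4 * Q'' ≤ Q' ∧ 2 * τ * ψ * Q'' ≤ Q' ∧
      A' * (4 * Q'') ^ 3 * (4 * σ * lam * Q'' / (1 - 4 * σ * lam * Q'')) +
        exp 1 * ψ * (2 * τ * ψ * Q'') ^ 2 * (τ * (ι₁ * lam + ι₂ / (2 * Q'') + ι₃ / (4 * Q'' ^ 2) + A' * Q'' / 4)) *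
          (Φ * (τ * (ι₁ * lam + ι₂ / (2 * Q'') + ι₃ / (4 * Q'' ^ 2) + A' * Q'' / 4)) /
            (1 - Φ * (τ * (ι₁ * lam + ι₂ / (2 * Q'') + ι₃ / (4 * Q'' ^ 2) + A' * Q'' / 4)))) ≤ A * Q' ^ 3) ∧
    -- (ii) the CE row in the SHARP read-out shapes, for the same `(λ, ι₁)`
    (∀ (lam ι₁ : ℝ), 0 ≤ lam → lam ≤ uf → 0 ≤ ι₁ → ι₁ * lam ≤ gmax * ((M : ℝ) / β) →
      ∀ (Aro Qro Qtot Atot : ℝ), Aro = C₁r / C₂r * (Ab + A) → Qro = C₂r ^ 2 * max Q' Qb →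
      Qtot = Dinc * max 1 (max Qro (max (4 * Q'') (2 * τ * ψ * Q''))) →
      Atot = Aro + Cinc * (A' * (4 * σ * lam * Q'' / (1 - 4 * σ * lam * Q'')) +
        exp 1 * (τ * (ι₁ * lam + ι₂ / (2 * Q'') + ι₃ / (4 * Q'' ^ 2) + A' * Q'' / 4)) *
          (Φ * (τ * (ι₁ * lam + ι₂ / (2 * Q'') + ι₃ / (4 * Q'' ^ 2) + A' * Q'' / 4)) /
            (1 - Φ * (τ * (ι₁ * lam + ι₂ / (2 * Q'') + ι₃ / (4 * Q'' ^ 2) + A' * Q'' / 4)))) / (2 * τ * Q'')) →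
      Qtot * imagTimeWeight β M ^ 2 * Bf * max 1 (Atot / imagTimeWeight β M) ≤ CEf) := by
  -- §0 positivity of the r-free closed forms
  have he0 : (0 : ℝ) < klE0 := by norm_num [klE0]
  have hrG1 : ((2 : ℝ) ^ d)⁻¹ < 1 := inv_lt_one_of_one_lt₀ (one_lt_pow₀ (by norm_num) (by omega))
  have hrG0 : 0 < 1 - ((2 : ℝ) ^ d)⁻¹ := sub_pos.2 hrG1
  have h2d1 : (0 : ℝ) < (2 : ℝ) ^ d - 1 := by have := one_lt_pow₀ (by norm_num : (1 : ℝ) < 2) (by omega : d ≠ 0); linarith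
  have h2dne : (2 : ℝ) ^ d - 1 ≠ 0 := h2d1.ne'
  have hpW0 : 0 < pW := by rw [hpW]; norm_num
  have hpZ0 : 0 < pZ := by rw [hpZ]; positivity
  have hps0 : 0 < ps := by rw [hps]; positivity
  have hpt0 : 0 < pt := by rw [hpt]; positivity
  have hpp0 : 0 < pp := by rw [hpp]; positivity
  have hpφ0 : 0 < pφ := by rw [hpφ]; positivity
  have hpρ0 : 0 < pρ := by rw [hpρ]; positivity
  have hpκ0 : 0 < pκ := by rw [hpκ]; positivity
  have hK₁0 : 0 < K₁ := by rw [hK₁]; positivity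
  have hK₂0 : 0 < K₂ := by rw [hK₂]; positivity
  have hKx0 : 0 < Kx := by rw [hKx]; exact lt_max_of_lt_left hK₁0
  have hK₁x : K₁ ≤ Kx := by rw [hKx]; exact le_max_left _ _
  have hK₂x : K₂ ≤ Kx := by rw [hKx]; exact le_max_right _ _
  have hg0 : 0 < gmax := by rw [hgmax]; positivity
  have hg1 : gmax ≤ 1 := by rw [hgmax]; exact min_le_left _ _
  have hgK : gmax ≤ 1 / Kx := by rw [hgmax]; exact (min_le_right _ _).trans (min_le_left _ _)
  have hge : gmax ≤ 1 / (4 * exp 1 * pφ * pt) := by rw [hgmax]; exact (min_le_right _ _).trans (min_le_right _ _)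
  have hgK' : gmax * Kx ≤ 1 := by have h := mul_le_mul_of_nonneg_right hgK hKx0.le; rwa [one_div_mul_cancel hKx0.ne'] at h
  have hgK₁ : gmax * K₁ ≤ 1 := (mul_le_mul_of_nonneg_left hK₁x hg0.le).trans hgK'
  have hgK₂ : gmax * K₂ ≤ 1 := (mul_le_mul_of_nonneg_left hK₂x hg0.le).trans hgK'
  have hge4 : exp 1 * pφ * pt * gmax ≤ 1 / 4 := by
    have h := mul_le_mul_of_nonneg_left hge (by positivity : 0 ≤ exp 1 * pφ * pt)
    have heq : exp 1 * pφ * pt * (1 / (4 * exp 1 * pφ * pt)) = 1 / 4 := by field_simp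
    rwa [heq] at h
  have hq₀₀1 : 1 ≤ q₀₀ := by have h0 := mul_nonneg (add_nonneg hi₂ hx₆) hKx0.le; rw [hq₀₀]; linarith
  have hq₀₀0 : 0 < q₀₀ := lt_of_lt_of_le one_pos hq₀₀1
  have hQH0 : 0 < QH := by rw [hQH]; positivity
  have hBf1 : 1 ≤ Bf := (le_max_left _ _).trans hBf
  have hBf0 : 0 < Bf := lt_of_lt_of_le one_pos hBf1
  have hBfW_le : BfW ≤ Bf := (le_max_right _ _).trans hBf
  have hWκ0 : 0 ≤ (pW + pκ) * ab * QH := by positivity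
  obtain ⟨hyP₀0, hyPK₁, hyPK₂⟩ := levNumW_yP_small hK₁0.le hKx hi₂ hx₆ hWκ0 hq₀₀ hBfW hBfW_le hBf1 hyP₀
  have hyP0 : 0 ≤ yP := by rw [hyP]; positivity
  have hyL0 : 0 < yL := by rw [hyL]; positivity
  have haP0 : 0 ≤ aP := by rw [haP]; positivity
  have haA0 : 0 ≤ aA := by rw [haA]; positivity
  have haL0 : 0 < aL := by rw [haL]; positivity
  have hi₃g0 : 0 ≤ i₃g := by rw [hi₃g]; positivity
  have hi₂G0 : 0 ≤ i₂G := by rw [hi₂G]; positivity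
  have hsC0 : 0 ≤ sC := by rw [hsC]; positivity
  have hSfive0 : 0 ≤ Sfive := by rw [hSfive]; positivity
  have hR₆0 : 0 ≤ R₆ := by rw [hR₆]; positivity
  have hΘ0 : 0 ≤ Θ := by rw [hΘ]; positivity
  have huf0 : 0 < uf := by rw [huf]; positivity
  have hDinc0 : 0 ≤ Dinc := le_trans zero_le_one hDinc
  have hqT0 : 0 ≤ qT := by rw [hqT]; positivity
  have haT0 : 0 ≤ aT := by rw [haT]; positivity
  have hCEf0 : 0 ≤ CEf := by rw [hCEf]; exact mul_nonneg (mul_nonneg hqT0 hBf0.le) (le_trans zero_le_one (le_max_left _ _))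
  -- uf below each of its members
  have huf1 : uf ≤ 1 := by rw [huf]; exact min_le_left _ _
  have huf2 : uf ≤ 1 / (8 * ps * QH + 1) := by rw [huf]; exact (min_le_right _ _).trans (min_le_left _ _)
  have huf3 : uf ≤ 1 / (2 * exp 1 * pt * QH + 1) := by rw [huf]; exact (min_le_right _ _).trans ((min_le_right _ _).trans (min_le_left _ _))
  have huf5 : uf ≤ 1 / (2 * Sfive + 1) := by
    rw [huf]; exact (min_le_right _ _).trans ((min_le_right _ _).trans ((min_le_right _ _).trans (min_le_left _ _)))
  have huf6 : uf ≤ 1 / (R₆ + 1) := by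
    rw [huf]; exact (min_le_right _ _).trans ((min_le_right _ _).trans ((min_le_right _ _).trans ((min_le_right _ _).trans (min_le_left _ _))))
  have hufΘ : uf ≤ 1 / (4 * Θ + 1) := by
    rw [huf]; exact (min_le_right _ _).trans ((min_le_right _ _).trans ((min_le_right _ _).trans ((min_le_right _ _).trans (min_le_right _ _))))
  refine ⟨huf0, hCEf0, hBf1, hg0, ?_⟩
  -- §1 the binders
  intro β M _ hβ hβM Ab Qb hAbs hQb0 hQbs κb αb crb ccb hκb hαb hcrb hccb W Z σ τ ψ Φ hW hZ hσ hτ hψ hΦ ι₂ ι₃ hι₂ hι₃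
    κA q₀ Q'' ρ Q' a X Y A A' hκA hq₀ hQ'' hρ hQ' ha hX hY hA hA'
  have hM0 : (0 : ℝ) < M := Nat.cast_pos.2 (Nat.pos_of_ne_zero (NeZero.ne M))
  have hβ0 : β ≠ 0 := hβ.ne'
  have hMne : (M : ℝ) ≠ 0 := hM0.ne'
  set r : ℝ := β / M with hr
  have hr0 : 0 < r := by positivity
  have hr1 : r ≤ 1 := by rw [hr, div_le_one hM0]; exact hβM
  have hMβ : (M : ℝ) / β = 1 / r := by rw [hr]; field_simp
  have hMβ2 : ((M : ℝ) / β) ^ 2 = 1 / r ^ 2 := by rw [hMβ]; field_simp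
  have hitw : imagTimeWeight β M = r / 2 := by rw [imagTimeWeight, hr]; field_simp
  have hgr : gmax * ((M : ℝ) / β) = gmax / r := by rw [hMβ, mul_one_div]
  -- §2 the pins in closed form, then eliminate `W Z σ Φ ψ τ ρ κA`
  have hαb' : αb = Cb * (4 : ℝ) ^ d / klE0 * ((M : ℝ) / β) := by rw [hαb]; ring
  have hW' : W = pW := by rw [hpW]; exact levPinW_W hCJ.ne' hβ0 hMne hcrb hccb hW
  have hZ' : Z = pZ := by rw [hpZ]; exact levPinW_Z hβ0 hMne hccb hZ
  have hσ' : σ = ps * r ^ 2 := by rw [hps, hr]; exact levPinW_σ hCκ hCJ.ne' hβ0 hMne hκb hccb hσ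
  have hτ' : τ = pt * r ^ 2 := by rw [hpt, hr]; exact levPinW_τ hCκ hCJ.ne' hβ0 hMne hκb hccb hτ
  have hψ' : ψ = pp / r ^ 2 := by rw [levPinW_ψ hCκ hCJ.ne' hβ0 hMne hκb hccb hψ, hMβ2, hpp]; ring
  have hΦ' : Φ = pφ / r := by rw [levPinW_Φ hCκ hCJ.ne' hβ0 hMne hκb hαb' hcrb hccb hΦ, hMβ, hpφ]; ring
  have hρ' : ρ = pρ := by rw [hρ, hpρ]; exact levPinW_ρ hCκ hCJ.ne' hβ0 hMne hκb hccb hψ hτ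
  clear hW hZ hσ hτ hψ hΦ hαb hαb'
  subst W Z σ Φ ψ τ
  have hκA' : κA = pκ := by rw [hκA, hpκ]
  clear hκA
  subst κA
  have hΦ0 : 0 ≤ pφ / r := by positivity
  have hτpos : 0 < pt * r ^ 2 := by positivity
  have hψ0 : 0 ≤ pp / r ^ 2 := by positivity
  have hσ0 : 0 ≤ ps * r ^ 2 := by positivity
  -- §3 the shaped data
  have hAb' : Ab = ab * r / Bf ^ 2 := hAbs
  have hAbpos : 0 < Ab := by rw [hAb']; positivity
  have hQbhi : Qb ≤ qb / r ^ 2 := by rw [hMβ2, mul_one_div] at hQbs; exact hQbs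
  have hq₀' : q₀ = q₀₀ / r ^ 2 := by rw [hq₀, hMβ2]; ring
  have hq₀0 : 0 ≤ q₀ := by rw [hq₀']; positivity
  obtain ⟨hQ'₁, hQ'1, hQ'₂⟩ := levNumW_Q'_bounds hr0 hr1 hpZ0.le hQb0 hQbhi hq₀₀0.le hq₀' hQ''
  rw [← hQH] at hQ'₂
  have hQ'0 : 0 < Q'' := lt_of_lt_of_le one_pos hQ'1
  have hQ'ne : Q'' ≠ 0 := hQ'0.ne'
  have hι₂0 : 0 ≤ ι₂ := by rw [hι₂]; positivity
  have hι₃0 : 0 ≤ ι₃ := by rw [hι₃]; positivity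
  have hι₂r : ι₂ ≤ i₂ / r ^ 3 := by
    have : ((M : ℝ) / β) ^ 3 = 1 / r ^ 3 := by rw [hMβ]; field_simp
    rw [hι₂, this]; exact le_of_eq (by ring)
  have hι₂r1 : ι₂ ≤ i₂ / (1 * r ^ 3) := by rw [one_mul]; exact hι₂r
  have hι₃r : ι₃ ≤ x₆ / r ^ 5 := by
    have : ((M : ℝ) / β) ^ 5 = 1 / r ^ 5 := by rw [hMβ]; field_simp
    rw [hι₃, this]; exact le_of_eq (by ring)
  have hX0 : 0 ≤ X := by rw [hX]; positivity
  have hWZX : pW * pZ ^ 3 * X = ι₃ := by rw [hX]; field_simp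
  -- NumericsG's four-leg slot carrying the two-leg budget: `ι₂ᴳ = ι₂ + 2Q″·(gmax/r)`, so that `ι₂ᴳ/(2Q″) = ι₂/(2Q″) + gmax/r`
  obtain ⟨ι₂G, hι₂Gd⟩ : ∃ x : ℝ, x = ι₂ + 2 * Q'' * (gmax / r) := ⟨_, rfl⟩
  have hι₂G0 : 0 ≤ ι₂G := by rw [hι₂Gd]; positivity
  have hι₂Gq : ι₂G / (2 * Q'') = ι₂ / (2 * Q'') + gmax / r := by rw [hι₂Gd]; field_simp
  have hι₂Gr : ι₂G ≤ i₂G / (1 * r ^ 3) := by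
    have h2 : 2 * Q'' * (gmax / r) ≤ 2 * (QH / r ^ 2) * (gmax / r) := by gcongr
    have heq : i₂G / (1 * r ^ 3) = i₂ / r ^ 3 + 2 * (QH / r ^ 2) * (gmax / r) := by rw [hi₂G]; field_simp
    rw [heq, hι₂Gd]; exact add_le_add hι₂r h2
  have hYG : Y = ι₂G / (2 * Q'') + pW * pZ ^ 3 * X / (4 * Q'' ^ 2) + a * Q'' / 2 := by rw [hι₂Gq, hY, hgr]; ring
  -- `Y` two-sided (the budget-free part by `levNumW_Y_bounds`), `A A′` bounds
  obtain ⟨Y₀, hY₀⟩ : ∃ x : ℝ, x = ι₂ / (2 * Q'') + pW * pZ ^ 3 * X / (4 * Q'' ^ 2) + a * Q'' / 2 := ⟨_, rfl⟩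
  obtain ⟨hY₁, hY₂⟩ := levNumW_Y_bounds (a₁ := pW * Ab) (a₂ := Ab) hr0 hpW0 hpZ0 hpκ0.le hab0.le hBf1 hq₀₀0 hQ'₁ hQ'₂ hι₂0 hι₂r hι₃0 hι₃r
    hX hAb' rfl rfl ha hY₀
  rw [← hyL] at hY₁; rw [← hyP₀] at hY₂
  have hYY₀ : Y = Y₀ + gmax / r := by rw [hY, hY₀, hgr]
  have hY₁' : yL / r ≤ Y := by rw [hYY₀]; linarith [div_nonneg hg0.le hr0.le]
  have hY₂' : Y ≤ yP / r := by rw [hYY₀, hyP, add_div]; exact add_le_add hY₂ le_rfl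
  have hY0 : 0 ≤ Y := le_trans (by positivity) hY₁'
  obtain ⟨hA₁, hA₂⟩ := levNum_A_bounds hr0 hd hpκ0 hq₀₀0 hyL0.le hY₁' hY₂' hQ'₁ hQ'₂ hA
  rw [← haL] at hA₁; rw [← haA] at hA₂
  have hA0 : 0 ≤ A := le_trans (by positivity) hA₁
  have hApos : 0 < A := lt_of_lt_of_le (by positivity) hA₁
  obtain ⟨hA'0, hA'₂⟩ := levNumW_A'_bounds (a₁ := pW * Ab) (a₂ := Ab) hr0 hpW0 hpκ0.le hab0.le hBf1 hq₀₀0 hY0 hY₂' hQ'₁ hAb' rfl rfl ha hA'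
  rw [← haP] at hA'₂
  -- NumericsG's pinned six-leg slot `ι₃ᴳ = WZ³X + A′Q″³ ≥ ι₃` and its bound
  obtain ⟨ι₃G, hι₃G⟩ : ∃ x : ℝ, x = pW * pZ ^ 3 * X + A' * Q'' ^ 3 := ⟨_, rfl⟩
  have hAQ3 : 0 ≤ A' * Q'' ^ 3 := by positivity
  have hι₃le : ι₃ ≤ ι₃G := by rw [hι₃G, ← hWZX]; linarith
  have hι₃G0 : 0 ≤ ι₃G := hι₃0.trans hι₃le
  have hι₃Gr : ι₃G ≤ i₃g / r ^ 5 := by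
    have hXr : X ≤ x₆ / (pW * pZ ^ 3) / (1 ^ 2 * r ^ 5) := by
      rw [one_pow, one_mul, hX, div_right_comm]; exact div_le_div_of_nonneg_right hι₃r (by positivity)
    have h := levNum_ι₃_le (W := pW) (Z := pZ) (B := 1) (x₆ := x₆ / (pW * pZ ^ 3)) hr0 hpW0.le hpZ0.le le_rfl hXr hA'0 hA'₂ hQ'0 hQ'₂ hι₃G
    have heq : pW * pZ ^ 3 * (x₆ / (pW * pZ ^ 3)) / 1 ^ 2 + aP * QH ^ 3 = x₆ + aP * QH ^ 3 := by field_simp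
    rw [heq, ← hi₃g] at h; exact h
  -- §4 NumericsG's residual rows: blocking, the two amplitude rows (the budget `gmax` absorbed through `gmax·K ≤ 1` with the doubled ratios)
  have hρe : max 4 (2 * (pt * r ^ 2) * (pp / r ^ 2)) = pρ := hρ.symm.trans hρ'
  have hQ'ρ : Q' = pρ * Q'' := by rw [hQ', hρ']
  have hblock := levNumW_block (Z := pZ) (τ := pt * r ^ 2) (ψ := pp / r ^ 2) (κQ := C₂ ^ 2 * ((2 : ℝ) ^ (d - 1))⁻¹) rfl hρe rfl hblockW
  have hYr : Y * r ≤ yP := (le_div_iff₀ hr0).1 hY₂'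
  have hyPK₁' : yP * K₁ ≤ 2 := by rw [hyP, add_mul]; linarith
  have hyPK₂' : yP * K₂ ≤ 2 := by rw [hyP, add_mul]; linarith
  have amp1 : 8 * (pφ / r) * (pt * r ^ 2) * Y ≤ 1 := by
    calc 8 * (pφ / r) * (pt * r ^ 2) * Y = 8 * pφ * pt * (Y * r) := by field_simp
      _ ≤ 8 * pφ * pt * yP := by gcongr
      _ = yP * K₁ / 2 := by rw [hK₁]; ring
      _ ≤ 1 := by linarith
  have amp2 : 128 * exp 1 * (pp / r ^ 2) ^ 3 * (pt * r ^ 2) ^ 4 * (pφ / r) * pκ * Y ≤ (1 - ((2 : ℝ) ^ d)⁻¹) * ρ ^ 3 := by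
    rw [hρ']
    calc 128 * exp 1 * (pp / r ^ 2) ^ 3 * (pt * r ^ 2) ^ 4 * (pφ / r) * pκ * Y = 128 * exp 1 * pp ^ 3 * pt ^ 4 * pφ * pκ * (Y * r) := by
          field_simp
      _ ≤ 128 * exp 1 * pp ^ 3 * pt ^ 4 * pφ * pκ * yP := by gcongr
      _ = yP * K₂ / 2 * ((1 - ((2 : ℝ) ^ d)⁻¹) * pρ ^ 3) := by rw [hK₂]; field_simp; ring
      _ ≤ 1 * ((1 - ((2 : ℝ) ^ d)⁻¹) * pρ ^ 3) := mul_le_mul_of_nonneg_right (by linarith) (by positivity)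
      _ = (1 - ((2 : ℝ) ^ d)⁻¹) * pρ ^ 3 := one_mul _
  have ha₁pos : 0 < pW * Ab := by positivity
  have hrows := towerLevNumericsG_rows (κQ := C₂ ^ 2 * ((2 : ℝ) ^ (d - 1))⁻¹) hpW0 hpZ0 hpκ0 (by positivity) hrG1 hQb0 ha₁pos hAbpos.le hq₀0 hι₂G0
    hX0 hρ hQ'' hQ' ha hYG hA hA' hι₃G hblock amp1 amp2
  obtain ⟨⟨_, hQpos, _, _, _, _⟩, ⟨hfl1, hfl2, hfl3, hfl4, _, _, _⟩, ⟨hc1, hc2⟩, hN4, _⟩ := hrows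
  have hAQne : A * Q' ^ 3 ≠ 0 := by positivity
  -- the actual size `S(ι₁, λ)` is below NumericsG's size `S′` (two-leg slot zeroed, budget inside `ι₂ᴳ`, `ι₃ᴳ ≥ ι₃`)
  have hSS : ∀ (lam ι₁ : ℝ), ι₁ * lam ≤ gmax * ((M : ℝ) / β) →
      ι₁ * lam + ι₂ / (2 * Q'') + ι₃ / (4 * Q'' ^ 2) + A' * Q'' / 4 ≤ 0 * lam + ι₂G / (2 * Q'') + ι₃G / (4 * Q'' ^ 2) + A' * Q'' / 4 := by
    intro lam ι₁ hprod
    rw [hgr] at hprod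
    have h3 : ι₃ / (4 * Q'' ^ 2) ≤ ι₃G / (4 * Q'' ^ 2) := div_le_div_of_nonneg_right hι₃le (by positivity)
    rw [hι₂Gq, zero_mul, zero_add]; linarith
  refine ⟨⟨hA0, hQpos, hQ'0, hA'0, ?_, ?_, hfl1, hfl3⟩, ?_, ?_⟩
  · calc pW * (C₁ / C₂ * (8 : ℝ) ^ (d - 1) * (Ab + A / (1 - ((2 : ℝ) ^ d)⁻¹))) = pκ * (Ab + A / (1 - ((2 : ℝ) ^ d)⁻¹)) := by
          rw [hpκ]; ring
      _ ≤ A' := hfl2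
  · calc pZ * (C₂ ^ 2 * ((2 : ℝ) ^ (d - 1))⁻¹ * max Q' Qb) = pZ * (C₂ ^ 2 * ((2 : ℝ) ^ (d - 1))⁻¹) * max Q' Qb := by ring
      _ ≤ Q'' := hfl4
  -- (i) the eight kit rows
  · intro lam ι₁ hlam0 hlamuf hι₁0 hprod
    have hlam1 : lam ≤ 1 := hlamuf.trans huf1
    -- NumericsG's seven doors at the actual names (two-leg slot zeroed: doors 4 and 7 are trivial)
    have h2 := levNum_door2 (QH := QH) hr0 hps0.le rfl hQ'0 hQ'₂
    have h3 := levNum_door3 (QH := QH) hr0 hpt0.le rfl hQ'0 hQ'₂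
    have h5 := (levNum_door5 (ι₁ := 0) (i₁ := 0) hr0 hpφ0.le hpt0.le le_rfl rfl rfl le_rfl (by rw [zero_div]) hι₂G0 hι₂Gr hι₃G0 hι₃Gr
      hA'0 hA'₂ hQ'0 hQ'₂).2
    rw [div_one, ← hSfive] at h5
    have h6 := levNum_door6 hr0 hps0.le rfl hQ'0 hQ'₂ haL0 hA₁ hA'0 hA'₂ hpρ0 hQ'ρ; rw [← hR₆] at h6
    have hle : lam ≤ min 1 (min (1 / (8 * (ps * r ^ 2) * Q'' + 1)) (min (1 / (2 * exp 1 * (pt * r ^ 2) * Q'' + 1))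
        (min (1 / (4 * (pφ / r) * (pt * r ^ 2) * 0 + 1))
        (min (1 / (2 * (pφ / r * (exp 1 * (pt * r ^ 2) * 0 + (exp 1 * (pt * r ^ 2)) ^ 2 * ι₂G + (exp 1 * (pt * r ^ 2)) ^ 3 * ι₃G +
          A' * (exp 1 * (pt * r ^ 2) * Q'') ^ 2 / 2)) + 1))
        (min (A * Q' ^ 3 / (16 * (ps * r ^ 2) * Q'' * A' * (4 * Q'') ^ 3 + A * Q' ^ 3))
          (A * Q' ^ 3 / (16 * exp 1 * (pp / r ^ 2) * (2 * (pt * r ^ 2) * (pp / r ^ 2) * Q'') ^ 2 * (pφ / r) * (pt * r ^ 2) ^ 2 * 0 ^ 2 +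
            A * Q' ^ 3))))))) := by
      refine le_min hlam1 (le_min (hlamuf.trans (huf2.trans h2)) (le_min (hlamuf.trans (huf3.trans h3)) (le_min ?_
        (le_min (hlamuf.trans (huf5.trans h5)) (le_min (hlamuf.trans (huf6.trans h6)) ?_)))))
      · have : 1 / (4 * (pφ / r) * (pt * r ^ 2) * 0 + 1) = (1 : ℝ) := by norm_num
        rw [this]; exact hlam1
      · have : A * Q' ^ 3 / (16 * exp 1 * (pp / r ^ 2) * (2 * (pt * r ^ 2) * (pp / r ^ 2) * Q'') ^ 2 * (pφ / r) * (pt * r ^ 2) ^ 2 * 0 ^ 2 +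
            A * Q' ^ 3) = 1 := by
          have h0 : (16 * exp 1 * (pp / r ^ 2) * (2 * (pt * r ^ 2) * (pp / r ^ 2) * Q'') ^ 2 * (pφ / r) * (pt * r ^ 2) ^ 2 * 0 ^ 2 +
            A * Q' ^ 3) = A * Q' ^ 3 := by ring
          rw [h0, div_self hAQne]
        rw [this]; exact hlam1
    have hG := towerLevNumericsG_side_of_lam_le (ι₁ := 0) (κQ := C₂ ^ 2 * ((2 : ℝ) ^ (d - 1))⁻¹) hσ0 hΦ0 hψ0 hτpos hpW0 hpZ0 hpκ0 (by positivity)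
      hrG1 hQb0 ha₁pos hAbpos.le hq₀0 le_rfl hι₂G0 hX0 hρ hQ'' hQ' ha hYG hA hA' hι₃G hblock amp1 amp2 hlam0 hle
    obtain ⟨gx₁, gx₂, gx₃, gy, -, gclose⟩ := hG
    have hS0 : 0 ≤ ι₁ * lam + ι₂ / (2 * Q'') + ι₃ / (4 * Q'' ^ 2) + A' * Q'' / 4 := by positivity
    obtain ⟨my, mclose⟩ := levNumW_rows_monoS (σ := ps * r ^ 2) (Q := Q') (A := A) (A' := A') (lam := lam) (ψ := pp / r ^ 2) (Q' := Q'')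
      hΦ0 hτpos.le hψ0 hS0 (hSS lam ι₁ hprod)
    -- the θ-row with the product slot (`levNum_θ₀_le'`)
    obtain ⟨_, hx₃, _⟩ := levNum_x₃_le hr0 hpt0.le rfl hQ'0 hQ'₂ hlam0 (hlamuf.trans huf3)
    have hprod' : ι₁ * lam ≤ gmax / r := by rw [hgr] at hprod; exact hprod
    obtain ⟨_, _, hθ⟩ := levNum_θ₀_le' (i₂ := i₂) (i₃ := x₆) hr0 hpt0.le hpφ0.le rfl rfl hι₁0 hprod' hι₂0 hι₂r hι₃0 hι₃r hA'0 hA'₂ hQ'0 hQ'₂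
      hlam0 hlam1 hx₃ hΘ
    have gθ := lt_of_le_of_lt (hθ hge4 (hlamuf.trans hufΘ)) (by norm_num : (1 : ℝ) / 2 < 1)
    exact ⟨gx₁, gx₂, gx₃, my gy, gθ, hc1, hc2, mclose gy gclose⟩
  -- (ii) the CE row, sharp shapes
  · intro lam ι₁ hlam0 hlamuf hι₁0 hprod Aro Qro Qtot Atot hAro hQro hQtot hAtot
    have hlam1 : lam ≤ 1 := hlamuf.trans huf1
    obtain ⟨_, hx₁⟩ := levNum_x₁_le hr0 hps0.le rfl hQ'0 hQ'₂ hlam0 (hlamuf.trans huf2)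
    -- `S ≤ (gmax + sC)/r`
    have hx₆i : x₆ ≤ i₃g := by rw [hi₃g]; linarith [mul_nonneg haP0 (pow_nonneg hQH0.le 3)]
    have hι₃i : ι₃ ≤ i₃g / r ^ 5 := hι₃r.trans (div_le_div_of_nonneg_right hx₆i (by positivity))
    have hS := levNum_S_le (ι₁ := 0) (i₁ := 0) (B := 1) hr0 le_rfl hq₀₀0 hlam0 (by rw [zero_div]) hι₂0 hι₂r1 hι₃0 hι₃i hA'0 hA'₂ hQ'₁ hQ'₂
    have hprod' : ι₁ * lam ≤ gmax / r := by rw [hgr] at hprod; exact hprod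
    have hS0 : 0 ≤ ι₁ * lam + ι₂ / (2 * Q'') + ι₃ / (4 * Q'' ^ 2) + A' * Q'' / 4 := by positivity
    have hS' : ι₁ * lam + ι₂ / (2 * Q'') + ι₃ / (4 * Q'' ^ 2) + A' * Q'' / 4 ≤ (gmax + sC) / r := by
      have heq : (gmax + sC) / r = gmax / r + (0 * lam + i₂ / (2 * 1 * q₀₀) + i₃g / (4 * q₀₀ ^ 2) + aP * QH / 4) / r := by
        rw [hsC]; field_simp; ring
      rw [heq]; linarith
    -- `y ≤ 1/2`: the whole size is below NumericsG's λ-free size, which is `≤ 1/4`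
    have hy : pφ / r * (pt * r ^ 2 * (ι₁ * lam + ι₂ / (2 * Q'') + ι₃ / (4 * Q'' ^ 2) + A' * Q'' / 4)) ≤ 1 / 2 := by
      have h := hSS lam ι₁ hprod
      rw [zero_mul, zero_add] at h
      calc pφ / r * (pt * r ^ 2 * (ι₁ * lam + ι₂ / (2 * Q'') + ι₃ / (4 * Q'' ^ 2) + A' * Q'' / 4))
          ≤ pφ / r * (pt * r ^ 2 * (ι₂G / (2 * Q'') + ι₃G / (4 * Q'' ^ 2) + A' * Q'' / 4)) := by gcongr
        _ ≤ 1 / 4 := hN4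
        _ ≤ 1 / 2 := by norm_num
    have hAt := levNumW_Atot_le hr0 hτpos hq₀₀0 hQ'₁ hS0 hS' hx₁ hy hA₂ hA'0 hA'₂ hAb' hC₁r.le hC₂r hCinc.le hAro hAtot; rw [← haT] at hAt
    obtain ⟨hQtot0, hQt⟩ := levNumW_Qtot_le hr0 hr1 hpt0.le hpp0.le rfl rfl hQ'0 hQ'₂ hQb0 hQbhi hpρ0 hQ'ρ hDinc hQro hQtot; rw [← hqT] at hQt
    rw [hitw, hCEf]; exact levNum_CErow_le hr0 hBf1 hQtot0 hQt hAt

end Summit.HubbardSuperconductivity.HubbardSuperconductivity.Theorems.EngineV8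

end
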